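import Literature.AlgebraicGeometry.Motives.WeilJacobianGroup
import Literature.AlgebraicGeometry.Motives.JacobianDimensionOfBirationalSymmetricPower
import Literature.AlgebraicGeometry.Motives.AlbaneseByMaximality
import Literature.AlgebraicGeometry.Motives.CurveGeneralDivisorsNonempty
import Literature.AlgebraicGeometry.Motives.CurveGenusBaseChange
import Literature.AlgebraicGeometry.Motives.CechComplexPseudoCoherentGeneralProofs
import Literature.AlgebraicGeometry.Motives.VarietiesDimensionProofs
import HarnessLib

/-!
# Weil's construction of the Jacobian, IV: `dim J = g`, the map `C → J`, and `g ≤ dim 𝒥`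

Concluding `Motives/WeilJacobianGlue`, `…Symmetrize`, `…Group` (Milne, *Jacobian Varieties*, §7
Thm. 7.1): for `K = K̄` of characteristic `0`, `C` a smooth projective geometrically integral
curve with `genus ≤ g` and `W ≠ ∅`, Weil's abelian variety `J = WeilJacobian.Jac` satisfies

* `dim J = g` (`WeilJacobian.dim_Jac`): the chart `W ⊆ C⁽ᵍ⁾` embeds openly in `J`
  (`AbelianVariety.dim_eq_of_isOpenImmersion_symPowProj`, Milne Thm. 5.1 (a));
* the map `f : C → J`, `Q ↦ [Q − R₀(j₀)]` (`WeilJacobian.fJ`: the tuple morphism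
  `Q ↦ (…, Q, …)` followed by `σ : Cᵍ → J`), has `cls (f Q) = [Q − R₀(j₀)]` (`clsX_comp_fJ`) and
  GENERATES `J` (`generates_fJ`): the sum map `s_{g−1} : (C × C)ᵍ → J`,
  `((Sⱼ, Rⱼ))ⱼ ↦ Σⱼ (f(Sⱼ) − f(Rⱼ))`, has `cls ∘ s_{g−1} = [Σ[S] − Σ[R]]` (`clsX_pairsPt_pmSum`), so hits
  every `K`-point `[E − Σ[R]]` (`Ê(E) = Σ[S]`), and its image is closed;
* hence for every Jacobian `𝒥` of `C` in the sense of the universal property of `Motives/Jacobian`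
  the homomorphism `u : 𝒥 → J` through which the difference map `d_f` factors is surjective
  (`Generates.surjective_of_comp_eq`, `Motives/AlbaneseByMaximality`) and `g = dim J ≤ dim 𝒥`
  (`WeilJacobian.le_jacobian_dim_aux`).

Finally `curveGenus_le_jacobian_dim`: for EVERY smooth projective curve `C` over an algebraically
closed field of characteristic `0` and every `𝒥 : Jacobian C`, `genus(C) ≤ dim 𝒥` — the hypotheses
of the construction are discharged: geometric integrality (`geometricallyIntegral_of_isAlgClosed`),
the Čech pseudo-coherence of `C` (`cechComplex_pseudoCoherent_general_holds`), `genus(C_K) = genus(C)`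
(`curveGenus_curveBC`), and `W ≠ ∅` from `2g − 1` distinct `K`-points
(`nonempty_generalLocus_of_sections`; `infinite_algPoints`: a smooth curve over `K = K̄` has
infinitely many `K`-points, by Jacobson-ness and `dim C = 1`). This is the input of
`Motives/JacobianDimensionBettiProofs` (`2 dim 𝒥 = b₁(C)` over `ℂ`).

Mathlib searched (pin): `CategoryTheory.Hom.mul_def/one_def/inv_def`, `MonObj.comp_mul`,
`Fin.sum_univ_castSucc`, `Fintype.sum_eq_add_sum_compl`, `Infinite.natEmbedding`,
`closure_closedPoints`, `Finite.instDiscreteTopology`, `topologicalKrullDim_zero_of_discreteTopology`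
(all used).

## References

* J. S. Milne, *Jacobian Varieties*, in Cornell–Silverman (eds.), *Arithmetic Geometry* (1986),
  §5 Thm. 5.1 (a), §6 Prop. 6.1, §7 Thm. 7.1. [Milne1986JacobianVarieties]
* A. Weil, *Variétés abéliennes et courbes algébriques*, Hermann (1948). [Weil1948VarietesAbeliennes]
-/

noncomputable section

universe u

open CategoryTheory CategoryTheory.Limits AlgebraicGeometry MonoidalCategory CartesianMonoidalCategory
  TopologicalSpace MonObj
open Literature.NumberTheory.DiophantineGeometry
open Literature.NumberTheory.DiophantineGeometry.AlgFunctionField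
open Literature.AlgebraicGeometry.RelativeSpec

namespace Literature.AlgebraicGeometry.Motives

open RatFn FieldPoint CartierDivisor CurvePlaces

namespace WeilJacobian

variable {K : Type u} [Field K] [IsAlgClosed K] [CharZero K]
  (C : SchemeOver K) [IsIntegral C.left] [SmoothOfRelativeDimension 1 C.hom] [IsProper C.hom]
  [GeometricallyIntegral C.hom] (hC : IsProjectiveOver C) (hX : CechPseudoCoherentAt C) (g : ℕ)
  (hg : (genus K (curveBC C (strPt (K := K) K)).left.functionField : ℤ) ≤ g)
  (hW : (chartW C g hC).Nonempty)

/-! ### `dim J = g` -/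

/-- **`dim J = g`**: the chart `W ⊆ C⁽ᵍ⁾` (non-empty, of dimension `g`) embeds openly in `J`
(Milne Thm. 5.1 (a) in the form `AbelianVariety.dim_eq_of_isOpenImmersion_symPowProj`). [cite: Milne1986JacobianVarieties, §5 Thm. 5.1 (a) and §7 Thm. 7.1] -/
theorem dim_Jac : (Jac C hC hX g hg hW).dim = g := by
  haveI : @IsOpenImmersion (chartWOpens C g hC hX : Scheme.{u}) (Jac C hC hX g hg hW).X.left
      (chart C hC hX g hg (baseTuple C hC hX g hW)).left :=
    isOpenImmersion_chart_left C hC hX g hg _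
  exact AbelianVariety.dim_eq_of_isOpenImmersion_symPowProj hC (Jac C hC hX g hg hW) g (chartWOpens C g hC hX) hW
    (chart C hC hX g hg (baseTuple C hC hX g hW)).left

/-! ### `K`-points of the abelian variety `Jac` and their classes

The statements of `Motives/WeilJacobianGroup` are about the `K`-scheme `JK`; here they are
transported to the (definitionally equal) `K`-scheme `(Jac …).X`, on whose points the group
operations of the `Hom`-group are available. -/

/-- The chart `ι_R : W ↪ J` into the abelian variety. [folklore] -/
def chartX (R : Fin g → AlgPoints C K) : WK C hC hX g ⟶ (Jac C hC hX g hg hW).X := chart C hC hX g hg R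

/-- The map `σ : Cᵍ → J` into the abelian variety (base tuple `R₀ = baseTuple`). [folklore] -/
def sigmaX : powC C g ⟶ (Jac C hC hX g hg hW).X := sigmaK C hC hX g hg (baseTuple C hC hX g hW) hW

/-- The divisor class of a `K`-point of the abelian variety. [folklore] -/
def clsX (z : specOver K K ⟶ (Jac C hC hX g hg hW).X) : DivisorClass K (curveBC C (strPt (K := K) K)).left.functionField :=
  cls C hC hX g hg z

/-- `clsX` is injective. [folklore] -/
theorem clsX_injective : Function.Injective (clsX C hC hX g hg hW) := cls_injective C hC hX g hg

/-- Every `K`-point of the abelian variety is a chart point. [folklore] -/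
theorem exists_comp_chartX_eq (z : specOver K K ⟶ (Jac C hC hX g hg hW).X) :
    ∃ (R : Fin g → AlgPoints C K) (x : AlgPoints (WK C hC hX g) K), x ≫ chartX C hC hX g hg hW R = z :=
  exists_comp_chart_eq C hC hX g hg z

/-- `clsX [E − Σ[R]] = [Ê(E) − Σ[R]]`. [folklore] -/
theorem clsX_comp_chartX (R : Fin g → AlgPoints C K) (x : AlgPoints (WK C hC hX g) K) :
    clsX C hC hX g hg hW (x ≫ chartX C hC hX g hg hW R) =
      DivisorClass.mk (liftDiv C g hC (x ≫ ιW C hC hX g) - tupleDiv C R) :=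
  cls_comp_chart C hC hX g hg R x

/-- `clsX (a b) = clsX a + clsX b`. [folklore] -/
theorem clsX_mul (a b : specOver K K ⟶ (Jac C hC hX g hg hW).X) :
    clsX C hC hX g hg hW (a * b) = clsX C hC hX g hg hW a + clsX C hC hX g hg hW b := by
  rw [Hom.mul_def]
  exact cls_mul C hC hX g hg hW a b

/-- `clsX a⁻¹ = −clsX a`. [folklore] -/
theorem clsX_inv (a : specOver K K ⟶ (Jac C hC hX g hg hW).X) :
    clsX C hC hX g hg hW a⁻¹ = -clsX C hC hX g hg hW a := by
  rw [Hom.inv_def]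
  exact cls_inv C hC hX g hg hW a

/-- `clsX 1 = 0`. [folklore] -/
theorem clsX_one : clsX C hC hX g hg hW (1 : specOver K K ⟶ (Jac C hC hX g hg hW).X) = 0 := by
  rw [Hom.one_def]
  change cls C hC hX g hg (toUnit _ ≫ oneK C hC hX g hg hW) = 0
  rw [toUnit_oneK, cls_onePt]

/-- **`clsX (σ τ) = [Σ[τⱼ] − Σ[R₀]]`.** [folklore] -/
theorem clsX_comp_sigmaX (τ : AlgPoints (powC C g) K) :
    clsX C hC hX g hg hW (τ ≫ sigmaX C hC hX g hg hW) =
      DivisorClass.mk (coordDivisorAt C g (strPt (K := K) K) τ - tupleDiv C (baseTuple C hC hX g hW)) := by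
  obtain ⟨R', x, hx⟩ := exists_comp_chartX_eq C hC hX g hg hW (τ ≫ sigmaX C hC hX g hg hW)
  rw [← hx, clsX_comp_chartX, DivisorClass.mk_eq_mk_iff]
  exact Divisor.IsLinearlyEquivalent.symm'
    ((comp_sigmaK_eq_comp_chart_iff C hC hX g hg (baseTuple C hC hX g hW) hW τ R' x).mp hx.symm)

/-! ### The map `C → J`, `Q ↦ [Q − R₀(j₀)]` -/

variable (j₀ : Fin g)

/-- The tuple morphism `C → Cᵍ`, `Q ↦ (R₀₀, …, Q, …, R₀_{g−1})` (`Q` in position `j₀`, the fixed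
`K`-points `R₀ⱼ = baseTuple j` elsewhere). [folklore] -/
def fC : C ⟶ powC C g :=
  liftOver C.hom g fun j ↦ if j = j₀ then 𝟙 C else const C C (baseTuple C hC hX g hW j)

omit [CharZero K] in
/-- The tuple morphism on `K`-points. [folklore] -/
theorem comp_fC (Q : AlgPoints C K) :
    Q ≫ fC C hC hX g hW j₀ = tuplePt C (strPt (K := K) K) (Function.update (baseTuple C hC hX g hW) j₀ Q) := by
  rw [← tuplePt_comp_coord C g _ (Q ≫ fC C hC hX g hW j₀)]
  congr 1
  funext j
  rw [Category.assoc, fC, show liftOver C.hom g _ ≫ coord C g j = _ from liftOver_projOver C.hom g _ j]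
  by_cases h : j = j₀
  · subst h
    rw [if_pos rfl, Category.comp_id, Function.update_self]
  · rw [if_neg h, comp_const, Function.update_of_ne h]

/-- **The map `f : C → J`, `Q ↦ [Q − R₀(j₀)]`** (`σ` after the tuple morphism). [cite: Milne1986JacobianVarieties, §7 (the map `C → J`)] -/
def fJ : C ⟶ (Jac C hC hX g hg hW).X := fC C hC hX g hW j₀ ≫ sigmaX C hC hX g hg hW

omit [IsAlgClosed K] [CharZero K] [AlgebraicGeometry.IsIntegral (Over.left C)] in
/-- `Σⱼ [update R₀ j₀ Q ⱼ] − Σⱼ [R₀ⱼ] = [Q] − [R₀ j₀]`. [folklore] -/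
theorem tupleDiv_update_sub (R₀ : Fin g → AlgPoints C K) (Q : AlgPoints C K) :
    tupleDiv C (Function.update R₀ j₀ Q) - tupleDiv C R₀ = ptDiv C Q - ptDiv C (R₀ j₀) := by
  simp only [tupleDiv]
  rw [Fintype.sum_eq_add_sum_compl j₀, Fintype.sum_eq_add_sum_compl j₀ (fun j ↦ ptDiv C (R₀ j)),
    Function.update_self, add_sub_add_comm]
  have h : ∑ i ∈ {j₀}ᶜ, ptDiv C (Function.update R₀ j₀ Q i) = ∑ i ∈ {j₀}ᶜ, ptDiv C (R₀ i) :=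
    Finset.sum_congr rfl fun j hj ↦ by
      rw [Function.update_of_ne (fun h ↦ (Finset.mem_compl.mp hj) (Finset.mem_singleton.mpr h))]
  rw [h, sub_self, add_zero]

/-- **`clsX (f Q) = [Q − R₀(j₀)]`.** [cite: Milne1986JacobianVarieties, §7 (the map `C → J`)] -/
theorem clsX_comp_fJ (Q : AlgPoints C K) :
    clsX C hC hX g hg hW (Q ≫ fJ C hC hX g hg hW j₀) = DivisorClass.mk (ptDiv C Q - ptDiv C (baseTuple C hC hX g hW j₀)) := by
  rw [fJ, ← Category.assoc, comp_fC, clsX_comp_sigmaX, coordDivisorAt_tuplePt_eq_tupleDiv, tupleDiv_update_sub]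

/-- `f` vanishes at the constant `R₀(j₀)`: `const ≫ f = 1`. [folklore] -/
theorem const_comp_fJ : const C C (baseTuple C hC hX g hW j₀) ≫ fJ C hC hX g hg hW j₀ = 1 := by
  rw [Hom.one_def, const, Category.assoc, Category.assoc]
  congr 1
  show unitToSpecOver K ≫ baseTuple C hC hX g hW j₀ ≫ fJ C hC hX g hg hW j₀ = unitToSpecOver K ≫ onePt C hC hX g hg hW
  congr 1
  apply clsX_injective C hC hX g hg hW
  rw [clsX_comp_fJ, sub_self]
  change DivisorClass.mk 0 = cls C hC hX g hg (onePt C hC hX g hg hW)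
  rw [cls_onePt]
  rfl

/-! ### `f` generates `J`: the sum maps are surjective -/

/-- The `K`-point `((S₀, R₀), …, (S_n, R_n))` of `(C × C)ⁿ⁺¹`. [folklore] -/
def pairsPt : (n : ℕ) → (Fin (n + 1) → AlgPoints C K) → (Fin (n + 1) → AlgPoints C K) → AlgPoints (pmPow C n) K
  | 0, S, R => lift (S 0) (R 0)
  | n + 1, S, R => lift (pairsPt n (fun j ↦ S j.castSucc) (fun j ↦ R j.castSucc)) (lift (S (Fin.last _)) (R (Fin.last _)))

/-- **`clsX (s_n((S₀, R₀), …)) = Σⱼ (clsX f(Sⱼ) − clsX f(Rⱼ))`.** [folklore] -/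
theorem clsX_pairsPt_pmSum : ∀ (n : ℕ) (S R : Fin (n + 1) → AlgPoints C K),
    clsX C hC hX g hg hW (pairsPt C n S R ≫ pmSum (fJ C hC hX g hg hW j₀) n) =
      ∑ j, (clsX C hC hX g hg hW (S j ≫ fJ C hC hX g hg hW j₀) - clsX C hC hX g hg hW (R j ≫ fJ C hC hX g hg hW j₀))
  | 0, S, R => by
    rw [pmSum_zero, pairsPt, lift_diffOf, clsX_mul, clsX_inv, Fin.sum_univ_one]
    abel
  | n + 1, S, R => by
    rw [pmSum_succ, MonObj.comp_mul, clsX_mul, pairsPt, lift_fst_assoc, lift_snd_assoc, clsX_pairsPt_pmSum n,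
      lift_diffOf, clsX_mul, clsX_inv]
    conv_rhs => rw [Fin.sum_univ_castSucc]
    abel

/-- **Every `K`-point of `J` is a value of `s_{g−1}`**: `[Ê(E) − Σ[R]] = Σⱼ ([Sⱼ − R₀(j₀)] − [Rⱼ − R₀(j₀)])`
for `Ê(E) = Σ[S]`. [cite: Milne1986JacobianVarieties, §7 (proof of Thm. 7.1)] -/
theorem exists_pairsPt_pmSum_eq {n : ℕ} (hn : g = n + 1) (z : specOver K K ⟶ (Jac C hC hX g hg hW).X) :
    ∃ p : AlgPoints (pmPow C n) K, p ≫ pmSum (fJ C hC hX g hg hW j₀) n = z := by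
  obtain ⟨R, x, rfl⟩ := exists_comp_chartX_eq C hC hX g hg hW z
  obtain ⟨S, hS⟩ := exists_tuplePt_mk_eq C g hC (x ≫ ιW C hC hX g)
  refine ⟨pairsPt C n (fun j ↦ S (Fin.cast hn.symm j)) (fun j ↦ R (Fin.cast hn.symm j)), clsX_injective C hC hX g hg hW ?_⟩
  rw [clsX_pairsPt_pmSum, clsX_comp_chartX, ← hS, liftDiv_tuplePt_mk]
  simp only [clsX_comp_fJ]
  change ∑ j, (QuotientAddGroup.mk' _ _ - QuotientAddGroup.mk' _ _) = QuotientAddGroup.mk' _ _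
  simp only [← map_sub, ← map_sum]
  congr 1
  simp only [sub_sub_sub_cancel_right, Finset.sum_sub_distrib, tupleDiv]
  subst hn
  rfl

include hg in
/-- **`f : C → J` generates `J`** (`s_{g−1}` is surjective: on `K`-points by the above, and its
image is closed). [cite: Milne1986JacobianVarieties, §7 (proof of Thm. 7.1)] -/
theorem generates_fJ {n : ℕ} (hn : g = n + 1) : Generates (fJ C hC hX g hg hW j₀) := by
  refine ⟨n, ?_⟩
  haveI : IsProper (pmPow C n).hom := (isProper_and_geometricallyIntegral_pmPow C n).1
  haveI : IsProper (pmSum (fJ C hC hX g hg hW j₀) n).left := by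
    have h : IsProper ((pmSum (fJ C hC hX g hg hW j₀) n).left ≫ (Jac C hC hX g hg hW).X.hom) := by
      rw [Over.w]; infer_instance
    exact IsProper.of_comp _ (Jac C hC hX g hg hW).X.hom
  exact ⟨surjective_of_isClosed_range_of_forall_exists (pmSum (fJ C hC hX g hg hW j₀) n)
    (pmSum (fJ C hC hX g hg hW j₀) n).left.isClosedMap.isClosed_range (exists_pairsPt_pmSum_eq C hC hX g hg hW j₀ hn)⟩

include hC hX hg hW j₀ in
/-- **`g ≤ dim 𝒥` for every Jacobian `𝒥` of `C`** (in the sense of the universal property of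
`Motives/Jacobian`): the difference map `d_f : C × C → J` of Weil's `J` factors through `𝒥.diff`
by a homomorphism `u : 𝒥 → J`, under which the generating map `f` factors (`f(R₀(j₀)) = 0`); so `u`
is surjective (`Generates.surjective_of_comp_eq`) and `g = dim J ≤ dim 𝒥`. [cite: Milne1986JacobianVarieties, §6 Prop. 6.1 and §7 Thm. 7.1] -/
theorem le_jacobian_dim_aux {n : ℕ} (hn : g = n + 1) (𝒥 : Jacobian C) : g ≤ 𝒥.J.dim := by
  have hφ : lift (𝟙 C) (𝟙 C) ≫ diffOf (fJ C hC hX g hg hW j₀) = 1 := lift_self_diffOf _ _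
  have h : (lift (𝟙 C) (const C C (baseTuple C hC hX g hW j₀)) ≫ 𝒥.diff) ≫ (𝒥.desc _ hφ).hom.hom.hom =
      fJ C hC hX g hg hW j₀ := by
    rw [Category.assoc, 𝒥.fac _ hφ, lift_diffOf, Category.id_comp, const_comp_fJ, inv_one, _root_.mul_one]
  haveI := Generates.surjective_of_comp_eq (generates_fJ C hC hX g hg hW j₀ hn) (𝒥.desc _ hφ) h
  have hle := AbelianVariety.dim_le_of_surjective (𝒥.desc _ hφ)
  rwa [dim_Jac] at hle

end WeilJacobian

/-! ### Curves have infinitely many `K`-points -/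

section Infinite

variable {K : Type u} [Field K] [IsAlgClosed K] (C : SchemeOver K) [IsIntegral C.left]
  [SmoothOfRelativeDimension 1 C.hom]

/-- **A smooth curve over an algebraically closed field has infinitely many `K`-points**: were they
finite, the closed points would form a finite closed set, which is everything (Jacobson), so `C`
would be finite and `T₁`, hence discrete of dimension `0` — but `dim C = 1`. [folklore] -/
theorem infinite_algPoints : Infinite (AlgPoints C K) := by
  haveI : Smooth C.hom := SmoothOfRelativeDimension.smooth 1 _
  haveI : JacobsonSpace C.left := LocallyOfFiniteType.jacobsonSpace C.hom
  by_contra hinf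
  rw [not_infinite_iff_finite] at hinf
  have hcl : closedPoints C.left ⊆ Set.range (fun z : AlgPoints C K ↦ z.pt) := fun x hx ↦ by
    obtain ⟨z, hz⟩ := AlgPoints.exists_pt_eq_of_isClosed_singleton (X := C) (mem_closedPoints_iff.mp hx)
    exact ⟨z, hz⟩
  have hfin : (closedPoints C.left).Finite := (Set.finite_range _).subset hcl
  have hclosed : IsClosed (closedPoints C.left) := by
    rw [← Set.biUnion_of_singleton (closedPoints C.left)]
    exact hfin.isClosed_biUnion fun x hx ↦ mem_closedPoints_iff.mp hx
  have huniv : closedPoints C.left = Set.univ := by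
    rw [← hclosed.closure_eq]
    exact closure_closedPoints
  haveI : Finite C.left := Set.finite_univ_iff.mp (huniv ▸ hfin)
  haveI : T1Space C.left := ⟨fun x ↦ mem_closedPoints_iff.mp (huniv ▸ Set.mem_univ x)⟩
  have h0 := topologicalKrullDim_zero_of_discreteTopology C.left
  have h1 := topologicalKrullDim_eq_of_smoothOfRelativeDimension C.hom 1
  rw [h1] at h0
  exact absurd h0 (by norm_num)

end Infinite

/-! ### `g ≤ dim 𝒥` for every Jacobian -/

/-- **For a smooth projective curve `C` over an algebraically closed field of characteristic `0`
and every Jacobian `𝒥` of `C` (universal property of `Motives/Jacobian`), `genus(C) ≤ dim 𝒥`** —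
Weil's construction gives an abelian variety `J` of dimension `g` through which the generating map
`C → J` factors via `𝒥`. (The genus-`0` case is trivial; for `g ≥ 1` the chart `W` is non-empty as
`C` has `2g − 1` distinct `K`-points, `nonempty_generalLocus_of_sections`.) [cite: Milne1986JacobianVarieties, §7 Thm. 7.1 with §6 Prop. 6.1] -/
theorem curveGenus_le_jacobian_dim {K : Type u} [Field K] [IsAlgClosed K] [CharZero K] (C : SchemeOver K)
    [IsIntegral C.left] [SmoothOfRelativeDimension 1 C.hom] [IsProper C.hom] (hC : IsProjectiveOver C)
    (𝒥 : Jacobian C) : curveGenus C ≤ 𝒥.J.dim := by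
  rcases Nat.eq_zero_or_pos (curveGenus C) with h0 | hpos
  · rw [h0]; exact Nat.zero_le _
  obtain ⟨n, hn⟩ : ∃ n, curveGenus C = n + 1 := ⟨curveGenus C - 1, by omega⟩
  haveI : GeometricallyIntegral C.hom := geometricallyIntegral_of_isAlgClosed C.hom
  have hX : CechPseudoCoherentAt C := cechPseudoCoherentAt_of_general cechComplex_pseudoCoherent_general_holds C
  have hg : (genus K (curveBC C (strPt (K := K) K)).left.functionField : ℤ) ≤ curveGenus C := by
    exact_mod_cast (curveGenus_curveBC C (strPt (K := K) K)).le
  haveI := infinite_algPoints C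
  let a := Infinite.natEmbedding (AlgPoints C K)
  let s : Fin (2 * curveGenus C) → (𝟙_ (SchemeOver K) ⟶ C) := fun j ↦ unitToSpecOver K ≫ a j
  have hs : Function.Injective s := fun j₁ j₂ h ↦ by
    have h' := congrArg (toUnit (specOver K K) ≫ ·) h
    simp only [s] at h'
    rw [← Category.assoc, toUnit_unitToSpecOver, Category.id_comp, ← Category.assoc, toUnit_unitToSpecOver,
      Category.id_comp] at h'
    exact Fin.val_injective (a.injective h')
  have hW : (chartW C (curveGenus C) hC).Nonempty :=
    chartW_nonempty C (curveGenus C) hC (nonempty_generalLocus_of_sections C s hs (by omega))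
  exact WeilJacobian.le_jacobian_dim_aux C hC hX (curveGenus C) hg hW ⟨0, hpos⟩ hn 𝒥


end Literature.AlgebraicGeometry.Motives

end
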